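import Literature.Analysis.ODE.ConstantEnclosure
import Literature.Analysis.ODE.GlobalExistence
import HarnessLib

/-!
# Continuation of the constant enclosure test over a mesh (soundness of a step chain)

Topic `Literature/Analysis/ODE`. R. E. Moore, *Methods and Applications of Interval Analysis*
(SIAM 1979) [Moore1979], §8.1: once a step `[t₀, t₁]` of the initial value problem `y' = f(y)` has
been validated by the inclusion `P(B) ⊆ B` (the constant a priori enclosure test,
`Literature.Analysis.ODE.exists_solution_of_constantEnclosure`, eqs. (8.2)–(8.5)) and an enclosure
of `y(t₁)` is in hand, "we can continue the solution beyond `t₁`" from the new, **interval** initial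
condition (eq. (8.13): the test for a box of initial values), and so on along a mesh
`0 = τ₀ ≤ τ₁ ≤ … ≤ τ_N`. This file proves the soundness of such a chain of validated steps — the
statement a checker of a step-by-step enclosure certificate relies on ("Algorithm I" of
Nedialkov–Jackson–Corliss [NedialkovJacksonCorliss1999] iterated over the mesh, order one):

given boxes `W j` (enclosure of `y(τ j)`), `S j` (a priori enclosure on `[τ j, τ (j+1)]`) and
`[c j, d j] ⊇ f(S j)` with, for every `j < N`,
* `f` Lipschitz on `S j`,
* the step inclusion `W j + [0, τ (j+1) - τ j] · [c j, d j] ⊆ S j`,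
* the propagated end enclosure `W j + (τ (j+1) - τ j) · [c j, d j] ⊆ W (j+1)`,

every `y₀ ∈ W 0` has a solution on the whole horizon `[0, τ N]` with `y(τ j) ∈ W j` for all `j ≤ N`,
`y(t) ∈ S j` and `y(t) ∈ y(τ j) + (t - τ j) · [c j, d j]` on `[τ j, τ (j+1)]`
(`exists_solution_of_enclosureChain`); and if `f` is Lipschitz on bounded sets, EVERY solution on
`[0, τ N]` issued from `y₀` satisfies these enclosures (`solution_mem_of_enclosureChain`).
Proof: induction on `N`, one application of the single-step theorem per step, time shift
(the equation is autonomous) and gluing of solutions (`Literature.Analysis.ODE.solution_append`);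
uniqueness by Gronwall (`ODE_solution_unique_of_mem_Icc_right`).

USE: the soundness statement behind step-chain enclosure certificates of validated ODE
integrators (per-step witnesses `W j`, `S j`, `f(S j) ⊆ [c j, d j]`; the `cap.ode` certificates of
the engines programme carry the order-`K` Taylor form of the same per-step data, `K = 1` here).

## References

* [Moore1979] R. E. Moore, *Methods and Applications of Interval Analysis*, SIAM Studies in Applied
  Mathematics 2 (1979), §8.1 (continuation of the interval solution; eq. (8.13)).
  doi:10.1137/1.9781611970906
* [NedialkovJacksonCorliss1999] N. S. Nedialkov, K. R. Jackson, G. F. Corliss, Validated solutions of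
  initial value problems for ordinary differential equations, Appl. Math. Comput. 105 (1999) 21–68,
  Algorithm I. doi:10.1016/S0096-3003(98)10083-8
-/

noncomputable section

open Set Metric Filter Topology

open scoped NNReal

namespace Literature.Analysis.ODE

section Chain

variable {ι : Type*} [Fintype ι]

/-- A mesh given by nondecreasing successive nodes `τ j ≤ τ (j+1)` (`j < M`) is monotone on
`{0, …, M}`. [folklore] -/
private theorem mesh_mono {τ : ℕ → ℝ} {M : ℕ} (h : ∀ j < M, τ j ≤ τ (j + 1)) {i j : ℕ}
    (hij : i ≤ j) (hj : j ≤ M) : τ i ≤ τ j := by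
  induction j with
  | zero => rw [Nat.le_zero.1 hij]
  | succ j ih =>
    rcases Nat.of_le_succ hij with h1 | h1
    · exact (ih h1 (Nat.le_of_succ_le hj)).trans (h j (Nat.lt_of_succ_le hj))
    · rw [h1]

/-- Two solutions of the autonomous equation `y' = f(y)` on `[0, T]` (derivatives within `[0, T]`)
with the same initial value coincide, when `f` is Lipschitz on bounded sets (Gronwall, Mathlib's
`ODE_solution_unique_of_mem_Icc_right` in a ball containing both trajectories). [folklore] -/
private theorem eqOn_Icc_of_solutions {f : (ι → ℝ) → ι → ℝ}
    (hloc : ∀ ρ : ℝ, ∃ K' : ℝ≥0, LipschitzOnWith K' f (closedBall 0 ρ)) {T : ℝ} {y z : ℝ → ι → ℝ}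
    (hy : ∀ t ∈ Icc 0 T, HasDerivWithinAt y (f (y t)) (Icc 0 T) t)
    (hz : ∀ t ∈ Icc 0 T, HasDerivWithinAt z (f (z t)) (Icc 0 T) t) (h0 : y 0 = z 0) :
    EqOn y z (Icc 0 T) := by
  have hyc : ContinuousOn y (Icc 0 T) := fun s hs => (hy s hs).continuousWithinAt
  have hzc : ContinuousOn z (Icc 0 T) := fun s hs => (hz s hs).continuousWithinAt
  obtain ⟨Cy, hCy⟩ := isCompact_Icc.exists_bound_of_continuousOn hyc
  obtain ⟨Cz, hCz⟩ := isCompact_Icc.exists_bound_of_continuousOn hzc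
  obtain ⟨K', hK'⟩ := hloc (max Cy Cz)
  have hnhds : ∀ s ∈ Ico (0 : ℝ) T, Icc 0 T ∈ 𝓝[≥] s := fun s hs =>
    mem_of_superset (Icc_mem_nhdsGE hs.2) (Icc_subset_Icc_left hs.1)
  exact ODE_solution_unique_of_mem_Icc_right (v := fun _ => f)
    (s := fun _ => closedBall 0 (max Cy Cz)) (K := K') (fun _ _ => hK') hyc
    (fun s hs => (hy s (Ico_subset_Icc_self hs)).mono_of_mem_nhdsWithin (hnhds s hs))
    (fun s hs => mem_closedBall_zero_iff.2 ((hCy s (Ico_subset_Icc_self hs)).trans (le_max_left _ _)))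
    hzc
    (fun s hs => (hz s (Ico_subset_Icc_self hs)).mono_of_mem_nhdsWithin (hnhds s hs))
    (fun s hs => mem_closedBall_zero_iff.2 ((hCz s (Ico_subset_Icc_self hs)).trans (le_max_right _ _)))
    h0

/-- **Soundness of a chain of constant-enclosure steps (existence and enclosure).** Mesh
`τ 0 = 0 ≤ τ 1 ≤ … ≤ τ N`; for each step `j < N`: `f` Lipschitz on the a priori box `S j`,
`f(S j) ⊆ [c j, d j]` (`c j ≤ d j`), the step inclusion `y + s • v ∈ S j` for `y ∈ W j`,
`s ∈ [0, τ (j+1) - τ j]`, `v ∈ [c j, d j]` (Moore's `P(B) ⊆ B` for the interval initial condition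
`W j`, eq. (8.13)), and the propagated end enclosure `y + (τ (j+1) - τ j) • v ∈ W (j+1)`. Then every
`y₀ ∈ W 0` has a solution of `y' = f(y)`, `y(0) = y₀` on the whole horizon `[0, τ N]` with
`y (τ j) ∈ W j` (`j ≤ N`) and, on `[τ j, τ (j+1)]`, `y t ∈ S j` and `y t = y (τ j) + (t - τ j) • v`
for some `v ∈ [c j, d j]` (Moore 1979, §8.1: validate a step, then "continue the solution" from the
new interval initial condition). [cite: Moore1979, §8.1 eqs. (8.2)–(8.5), (8.13)] -/
theorem exists_solution_of_enclosureChain {f : (ι → ℝ) → ι → ℝ} {τ : ℕ → ℝ}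
    {W S : ℕ → Set (ι → ℝ)} {c d : ℕ → ι → ℝ} (N : ℕ) (hτ0 : τ 0 = 0)
    (hτ : ∀ j < N, τ j ≤ τ (j + 1)) (hf : ∀ j < N, ∃ K : ℝ≥0, LipschitzOnWith K f (S j))
    (hcd : ∀ j < N, c j ≤ d j) (hfS : ∀ j < N, MapsTo f (S j) (Icc (c j) (d j)))
    (hincl : ∀ j < N, ∀ y ∈ W j, ∀ s ∈ Icc 0 (τ (j + 1) - τ j), ∀ v ∈ Icc (c j) (d j),
      y + s • v ∈ S j)
    (hnext : ∀ j < N, ∀ y ∈ W j, ∀ v ∈ Icc (c j) (d j), y + (τ (j + 1) - τ j) • v ∈ W (j + 1))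
    {y₀ : ι → ℝ} (hy₀ : y₀ ∈ W 0) :
    ∃ y : ℝ → ι → ℝ, y 0 = y₀ ∧ (∀ t ∈ Icc 0 (τ N), HasDerivWithinAt y (f (y t)) (Icc 0 (τ N)) t) ∧
      (∀ j ≤ N, y (τ j) ∈ W j) ∧
      ∀ j < N, ∀ t ∈ Icc (τ j) (τ (j + 1)),
        y t ∈ S j ∧ ∃ v ∈ Icc (c j) (d j), y t = y (τ j) + (t - τ j) • v := by
  induction N with
  | zero =>
    refine ⟨fun _ => y₀, rfl, ?_, ?_, fun j hj => absurd hj (Nat.not_lt_zero j)⟩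
    · rw [hτ0]
      exact solution_const (fun _ => f) 0 y₀
    · intro j hj
      obtain rfl := Nat.le_zero.1 hj
      exact hy₀
  | succ N ih =>
    have hN : N < N + 1 := Nat.lt_succ_self N
    obtain ⟨y, hy0, hy, hyW, hyS⟩ := ih (fun j hj => hτ j (hj.trans hN))
      (fun j hj => hf j (hj.trans hN)) (fun j hj => hcd j (hj.trans hN))
      (fun j hj => hfS j (hj.trans hN)) (fun j hj => hincl j (hj.trans hN))
      (fun j hj => hnext j (hj.trans hN))
    -- the last step `[τ N, τ (N+1)]`
    have hab : τ N ≤ τ (N + 1) := hτ N hN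
    have ha0 : 0 ≤ τ N := by
      have := mesh_mono hτ (Nat.zero_le N) hN.le
      rwa [hτ0] at this
    have hyN : y (τ N) ∈ W N := hyW N le_rfl
    obtain ⟨K, hK⟩ := hf N hN
    obtain ⟨u, hu0, hu, huS⟩ := exists_solution_of_constantEnclosure hK (hcd N hN) (hfS N hN)
      (sub_nonneg.2 hab) (hincl N hN _ hyN)
    -- the shifted solution `s ↦ u (s - τ N)` on `[τ N, τ (N+1)]` (autonomy)
    have hβ : ∀ t ∈ Icc (τ N) (τ (N + 1)),
        HasDerivWithinAt (fun s => u (s - τ N)) (f (u (t - τ N))) (Icc (τ N) (τ (N + 1))) t := by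
      intro t ht
      have h1 := hu (t - τ N) ⟨sub_nonneg.2 ht.1, sub_le_sub_right ht.2 (τ N)⟩
      have h2 : HasDerivWithinAt (fun s => s - τ N) 1 (Icc (τ N) (τ (N + 1))) t :=
        (hasDerivWithinAt_id t _).sub_const (τ N)
      have hmaps : MapsTo (fun s => s - τ N) (Icc (τ N) (τ (N + 1))) (Icc 0 (τ (N + 1) - τ N)) :=
        fun s hs => ⟨sub_nonneg.2 hs.1, sub_le_sub_right hs.2 (τ N)⟩
      have h3 := h1.scomp t h2 hmaps
      simpa [Function.comp_def] using h3
    -- glue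
    have happ := solution_append (v := fun _ => f) (α := y) (β := fun s => u (s - τ N)) hy hβ ha0 hab
      (by simp [hu0])
    refine ⟨fun s => if s ≤ τ N then y s else u (s - τ N), by simp [ha0, hy0], happ, ?_, ?_⟩
    · -- values at the mesh points
      intro j hj
      rcases Nat.of_le_succ hj with hjN | hjN
      · have hja : τ j ≤ τ N := mesh_mono hτ hjN hN.le
        show (if τ j ≤ τ N then y (τ j) else u (τ j - τ N)) ∈ W j
        rw [if_pos hja]
        exact hyW j hjN
      · rw [hjN]
        obtain ⟨-, v, hv, hbv⟩ := huS (τ (N + 1) - τ N) ⟨sub_nonneg.2 hab, le_rfl⟩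
        have hmem : u (τ (N + 1) - τ N) ∈ W (N + 1) := hbv ▸ hnext N hN _ hyN v hv
        show (if τ (N + 1) ≤ τ N then y (τ (N + 1)) else u (τ (N + 1) - τ N)) ∈ W (N + 1)
        by_cases hba : τ (N + 1) ≤ τ N
        · have hbaeq : τ (N + 1) = τ N := le_antisymm hba hab
          rw [if_pos hba, hbaeq]
          have hu' : u (τ (N + 1) - τ N) = y (τ N) := by rw [hbaeq, sub_self, hu0]
          rwa [hu'] at hmem
        · rw [if_neg hba]
          exact hmem
    · -- step enclosures
      intro j hj t ht
      rcases Nat.lt_succ_iff_lt_or_eq.1 hj with hjN | hjN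
      · -- an earlier step: everything happens on `[0, τ N]`, where the glued function is `y`
        have hj1a : τ (j + 1) ≤ τ N := mesh_mono hτ (Nat.succ_le_of_lt hjN) hN.le
        have hta : t ≤ τ N := ht.2.trans hj1a
        have hja : τ j ≤ τ N := ht.1.trans hta
        show (if t ≤ τ N then y t else u (t - τ N)) ∈ S j ∧ ∃ v ∈ Icc (c j) (d j),
          (if t ≤ τ N then y t else u (t - τ N)) =
            (if τ j ≤ τ N then y (τ j) else u (τ j - τ N)) + (t - τ j) • v
        rw [if_pos hta, if_pos hja]
        exact hyS j hjN t ht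
      · -- the last step
        rw [hjN] at ht ⊢
        show (if t ≤ τ N then y t else u (t - τ N)) ∈ S N ∧ ∃ v ∈ Icc (c N) (d N),
          (if t ≤ τ N then y t else u (t - τ N)) =
            (if τ N ≤ τ N then y (τ N) else u (τ N - τ N)) + (t - τ N) • v
        rw [if_pos le_rfl]
        by_cases hta : t ≤ τ N
        · have hteq : t = τ N := le_antisymm hta ht.1
          rw [if_pos hta, hteq]
          refine ⟨?_, c N, left_mem_Icc.2 (hcd N hN), by simp⟩
          have hu0S := (huS 0 ⟨le_rfl, sub_nonneg.2 hab⟩).1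
          rwa [hu0] at hu0S
        · rw [if_neg hta]
          exact huS (t - τ N) ⟨sub_nonneg.2 ht.1, sub_le_sub_right ht.2 (τ N)⟩

/-- **Soundness of a chain of constant-enclosure steps (every solution is enclosed).** Under the
hypotheses of `exists_solution_of_enclosureChain`, if `f` is moreover Lipschitz on bounded sets,
then EVERY solution `z` of `z' = f(z)` on `[0, τ N]` with `z 0 = y₀ ∈ W 0` satisfies `z (τ j) ∈ W j`
for `j ≤ N` and, on `[τ j, τ (j+1)]`, `z t ∈ S j`, `z t ∈ z (τ j) + (t - τ j) • [c j, d j]`: the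
enclosures produced step by step contain the (unique) solution over the whole horizon
(Moore 1979, §8.1). [cite: Moore1979, §8.1 eqs. (8.2)–(8.5), (8.13)] -/
theorem solution_mem_of_enclosureChain {f : (ι → ℝ) → ι → ℝ} {τ : ℕ → ℝ}
    {W S : ℕ → Set (ι → ℝ)} {c d : ℕ → ι → ℝ} (N : ℕ) (hτ0 : τ 0 = 0)
    (hτ : ∀ j < N, τ j ≤ τ (j + 1)) (hf : ∀ j < N, ∃ K : ℝ≥0, LipschitzOnWith K f (S j))
    (hloc : ∀ ρ : ℝ, ∃ K' : ℝ≥0, LipschitzOnWith K' f (closedBall 0 ρ))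
    (hcd : ∀ j < N, c j ≤ d j) (hfS : ∀ j < N, MapsTo f (S j) (Icc (c j) (d j)))
    (hincl : ∀ j < N, ∀ y ∈ W j, ∀ s ∈ Icc 0 (τ (j + 1) - τ j), ∀ v ∈ Icc (c j) (d j),
      y + s • v ∈ S j)
    (hnext : ∀ j < N, ∀ y ∈ W j, ∀ v ∈ Icc (c j) (d j), y + (τ (j + 1) - τ j) • v ∈ W (j + 1))
    {y₀ : ι → ℝ} (hy₀ : y₀ ∈ W 0) {z : ℝ → ι → ℝ} (hz0 : z 0 = y₀)
    (hz : ∀ t ∈ Icc 0 (τ N), HasDerivWithinAt z (f (z t)) (Icc 0 (τ N)) t) :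
    (∀ j ≤ N, z (τ j) ∈ W j) ∧
      ∀ j < N, ∀ t ∈ Icc (τ j) (τ (j + 1)),
        z t ∈ S j ∧ ∃ v ∈ Icc (c j) (d j), z t = z (τ j) + (t - τ j) • v := by
  obtain ⟨y, hy0, hy, hyW, hyS⟩ :=
    exists_solution_of_enclosureChain N hτ0 hτ hf hcd hfS hincl hnext hy₀
  have hEq : EqOn y z (Icc 0 (τ N)) := eqOn_Icc_of_solutions hloc hy hz (hy0.trans hz0.symm)
  have hmemτ : ∀ j ≤ N, τ j ∈ Icc 0 (τ N) := fun j hj => by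
    refine ⟨?_, mesh_mono hτ hj le_rfl⟩
    have := mesh_mono hτ (Nat.zero_le j) hj
    rwa [hτ0] at this
  refine ⟨fun j hj => ?_, fun j hj t ht => ?_⟩
  · rw [← hEq (hmemτ j hj)]
    exact hyW j hj
  · have ht' : t ∈ Icc 0 (τ N) :=
      ⟨(hmemτ j hj.le).1.trans ht.1, ht.2.trans (hmemτ (j + 1) (Nat.succ_le_of_lt hj)).2⟩
    rw [← hEq ht', ← hEq (hmemτ j hj.le)]
    exact hyS j hj t ht

end Chain

end Literature.Analysis.ODE
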